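import Summits.ResolutionOfSingularities.ResolutionOfSingularities.Theorems.FrobeniusLadderFInjectiveMacaulayficationHypersurfaceOriginNotFull
import Summits.ResolutionOfSingularities.ResolutionOfSingularities.Theorems.FrobeniusLadderFInjectiveMacaulayficationCICodimTwoCM
import HarnessLib

/-!
# THE BED Ω ROW ENGINE (pencil floors `(M₁, B)` on a regular class model): the NON-FULL direction of (†) — `M₁^j·B^{p−1−j} ∈ 𝔪^{[p]}` for ALL `j` ⇒ `(M₁·w − B)^{p−1} ∈ 𝔪^{[p]}`
# for EVERY `w` — the pencil charts `{M₁·W = B}`, `{B·U = M₁}` NOT FULL at every k-point of the fibre `ℙ¹_Q`, and their CM clause as codimension-2 complete intersections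
# (crux `FInjectiveMacaulayfication` stmt-ResolutionOfSingularities-15315, chain w45a; res-L1-w45a-plan-1 BOOKED 01:57Z queue (4) «`…PencilFedder.lean` = THE BED Ω ROW ENGINE, kernel form of
# R22.24 (i)+(ii): (a) `pencil_pow_mem_frobeniusPower` …; (b) `pencilFloor_not_full_of_deep` …; (c) `pencil_legal` …»; (†) is res-L1-w45a-tri-2 g20's criterion (Q17 BED Ω break-test); seat
# res-L1-w45a-stub-1 g14)

[OURS · L1 W4.5a] Support file (`--supports stmt-ResolutionOfSingularities-15315 --as helper`); def-free; UNCONDITIONAL; no named fact; NOT a statement of any manuscript. An engine for future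
BED Ω kernel rows (Ω₁ on B9 is next-generation material); nothing of the crux is proved. AI-written (AI review is weaker than expert review).

SETTING. `X̃` a regular class model with boundary `E`, `Q ∈ E`, local coordinates `x₀..x_{n−1}` at `Q`; the floor is the 2-generated `E`-cosupported ideal `(M₁, B)` (`M₁` a monomial in the
boundary variables, `B` arbitrary, both vanishing at `Q`); `S′ = Bl_{(M₁,B)} X̃` has the charts `{M₁·W − B = 0}` (`W = B/M₁`) and `{B·U − M₁ = 0}` over `Q`, with fibre `ℙ¹_Q`.
* §1 (any commutative ring, any ideal `J`) ★ `pencil_pow_mem` — if `M^j·B^{p−1−j} ∈ J` for all `j ≤ p−1` then `(M·w − B)^{p−1} ∈ J` for EVERY ring element `w` (binomial theorem: each term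
  is `± C(p−1,j)·w^j · M^jB^{p−1−j}`); `pencil_pow_mem'` — likewise `(B·u − M)^{p−1} ∈ J`. (The desk's `pencil_pow_mem_frobeniusPower` with `J = 𝔪^{[p]}`, and since `w` is arbitrary the
  TRANSLATES `w = W + w₀` are covered: every point of the fibre, not only the chart origins.)
* §2 (hypersurface letter, `k` any field of characteristic `p`) for `M, B ∈ k[X₀..X_{n−1}]` with `M(0) = B(0) = 0`, `M ≠ 0`, and the DEEP condition `∀ j ≤ p−1, M^jB^{p−1−j} ∈ (X_i^p)`:
  `rename_mem_span_pow` (plumbing), ★ `pencilChart_not_full_at (w₀ : k)` — the origin of `V(M·(X_n + w₀) − B) ⊂ 𝔸^{n+1}` is NOT `FullCl p` (= the point `(Q, w₀)` of the `W`-chart in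
  coordinates centred there), ★ `pencilChart_not_full_infty` — the origin of `V(B·X_n − M)` is NOT `FullCl p` (the point `W = ∞`). Hence, in the row letter: the pencil floor is NOT FULL
  at EVERY k-point of `ℙ¹_Q` (✓ `HypersurfaceOriginNotFull.not_fullCl_stalk_origin_of_fedder_mem`).
* §3 (legality, CM half) `pencilChart_cmCl` — on a class-model chart `k[Y]/(G)` (`G` prime) the pencil chart `k[Y, W]/(G, M·W − B)` satisfies the CM clause at every stalk as soon as
  `G ∤ M·W − B` (✓ `CICodimTwoCM.cmCl_stalk_of_prime_of_not_dvd`); `not_dvd_pencil_of_not_dvd` — `G ∤ M` (with `G`, `M`, `B` free of `W`) suffices. Integrality of the chart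
  (`(G, M·W − B)` prime ⟸ `(M, B)` a regular sequence mod `G`) is NOT proved here — per-row hypothesis.
[cite: Fedder1983, Prop. 1.7 and Thm. 1.12] [folklore]
-/

-- single-problem summit: the doubled namespace component is forced
set_option linter.dupNamespace false

noncomputable section

namespace Summit.ResolutionOfSingularities.ResolutionOfSingularities.Theorems.FInjectiveMacaulayfication.PencilFedder

open CategoryTheory CategoryTheory.Limits AlgebraicGeometry TopologicalSpace IsLocalRing MvPolynomial
open Literature.AlgebraicGeometry.Resolution
open Summit.ResolutionOfSingularities.ResolutionOfSingularities.Theorems.FInjectiveMacaulayfication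
open SliceableCentre

/-! ## §1 The binomial engine (any ring, any ideal) -/

/-- ★ **(†), NON-FULL direction**: if `M^j·B^{p−1−j} ∈ J` for all `j ≤ p−1` then `(M·w − B)^{p−1} ∈ J` for every `w`. [elementary; cite: Fedder1983, Prop. 1.7 (context)] -/
theorem pencil_pow_mem {S : Type} [CommRing S] (J : Ideal S) (p : ℕ) (M B : S) (hdeep : ∀ j ≤ p - 1, M ^ j * B ^ (p - 1 - j) ∈ J) (w : S) :
    (M * w - B) ^ (p - 1) ∈ J := by
  rw [sub_eq_add_neg, add_pow]
  refine Ideal.sum_mem _ fun j hj => ?_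
  rw [Finset.mem_range] at hj
  have e : (M * w) ^ j * (-B) ^ (p - 1 - j) * ((p - 1).choose j : S) = (w ^ j * (-1) ^ (p - 1 - j) * ((p - 1).choose j : S)) * (M ^ j * B ^ (p - 1 - j)) := by
    rw [mul_pow, neg_eq_neg_one_mul, mul_pow]; ring
  rw [e]
  exact Ideal.mul_mem_left _ _ (hdeep j (by omega))

/-- **The `U`-chart twin**: `(B·u − M)^{p−1} ∈ J` under the same hypothesis. [elementary] -/
theorem pencil_pow_mem' {S : Type} [CommRing S] (J : Ideal S) (p : ℕ) (M B : S) (hdeep : ∀ j ≤ p - 1, M ^ j * B ^ (p - 1 - j) ∈ J) (u : S) :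
    (B * u - M) ^ (p - 1) ∈ J := by
  refine pencil_pow_mem J p B M (fun j hj => ?_) u
  have h := hdeep (p - 1 - j) (by omega)
  rw [show p - 1 - (p - 1 - j) = j by omega, mul_comm] at h
  exact h

/-! ## §2 The pencil charts are NOT FULL over `Q` (hypersurface letter) -/

/-- Plumbing: `∂_{X_n}` kills every polynomial coming from `k[X₀..X_{n−1}]`. [elementary] -/
theorem pderiv_last_rename_castSucc (k : Type) [Field k] {n : ℕ} (q : MvPolynomial (Fin n) k) :
    pderiv (Fin.last n) (rename (Fin.castSucc : Fin n → Fin (n + 1)) q) = 0 := by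
  induction q using MvPolynomial.induction_on with
  | C c => rw [rename_C, pderiv_C]
  | add p q hp hq => rw [map_add, map_add, hp, hq, add_zero]
  | mul_X p j hp => rw [map_mul, rename_X, Derivation.leibniz, hp, smul_zero, add_zero, pderiv_X_of_ne (Fin.castSucc_lt_last j).ne, smul_zero]

/-- Plumbing: `rename castSucc` carries `(X_i^p : i < n)` into `(X_i^p : i ≤ n)`. [plumbing] -/
theorem rename_mem_span_pow (k : Type) [Field k] {n : ℕ} (p : ℕ) (q : MvPolynomial (Fin n) k)
    (hq : q ∈ Ideal.span (Set.range fun i : Fin n => (X i : MvPolynomial (Fin n) k) ^ p)) :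
    rename (Fin.castSucc : Fin n → Fin (n + 1)) q ∈ Ideal.span (Set.range fun i : Fin (n + 1) => (X i : MvPolynomial (Fin (n + 1)) k) ^ p) := by
  have h := Ideal.mem_map_of_mem (rename (Fin.castSucc : Fin n → Fin (n + 1))).toRingHom hq
  rw [Ideal.map_span] at h
  refine (Ideal.span_le.mpr ?_) h
  rintro _ ⟨_, ⟨i, rfl⟩, rfl⟩
  exact Ideal.subset_span ⟨Fin.castSucc i, by simp [rename_X]⟩

/-- ★ **THE `W`-CHART IS NOT FULL AT EVERY k-POINT OF THE FIBRE**: for `M, B ∈ k[X₀..X_{n−1}]` with `M ≠ 0`, `M(0) = B(0) = 0` and the deep condition `M^jB^{p−1−j} ∈ (X_i^p)` for all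
`j ≤ p−1`, and every `w₀ ∈ k`: the origin of `V(M·(X_n + w₀) − B) ⊂ 𝔸^{n+1}` — i.e. the point `(Q, w₀)` of the chart `{M·W = B}` in coordinates centred there — is NOT `FullCl p`.
[OURS · certificate; cite: Fedder1983, Thm. 1.12] -/
theorem pencilChart_not_full_at (k : Type) [Field k] (p : ℕ) [Fact p.Prime] [CharP k p] {n : ℕ} (M B : MvPolynomial (Fin n) k) (hM : M ≠ 0)
    (hM0 : constantCoeff M = 0) (hB0 : constantCoeff B = 0)
    (hdeep : ∀ j ≤ p - 1, M ^ j * B ^ (p - 1 - j) ∈ Ideal.span (Set.range fun i : Fin n => (X i : MvPolynomial (Fin n) k) ^ p)) (w₀ : k)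
    (G : MvPolynomial (Fin (n + 1)) k)
    (hG : G = rename (Fin.castSucc : Fin n → Fin (n + 1)) M * (X (Fin.last n) + C w₀) - rename (Fin.castSucc : Fin n → Fin (n + 1)) B)
    (v : Spec (.of (MvPolynomial (Fin (n + 1)) k ⧸ Ideal.span {G})))
    (hv : v.asIdeal = Ideal.span (Set.range fun j : Fin (n + 1) => Ideal.Quotient.mk (Ideal.span {G}) (X j))) :
    ¬ FullCl p ((Spec (.of (MvPolynomial (Fin (n + 1)) k ⧸ Ideal.span {G}))).presheaf.stalk v) := by
  have hG0 : G ≠ 0 := by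
    -- kill `B` and the constant shift by differentiating in `X_n`: `∂_n G = M ≠ 0`
    intro h0
    have hd : pderiv (Fin.last n) G = rename (Fin.castSucc : Fin n → Fin (n + 1)) M := by
      rw [hG, map_sub, Derivation.leibniz, pderiv_last_rename_castSucc k M, pderiv_last_rename_castSucc k B, map_add, pderiv_X_self, pderiv_C]
      simp
    rw [h0, map_zero] at hd
    exact hM (rename_injective _ (Fin.castSucc_injective _) (by rw [map_zero]; exact hd.symm))
  have hc : constantCoeff G = 0 := by
    rw [hG, map_sub, map_mul, map_add, constantCoeff_rename, constantCoeff_rename, constantCoeff_X, constantCoeff_C, hM0, hB0]; ring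
  refine HypersurfaceOriginNotFull.not_fullCl_stalk_origin_of_fedder_mem p k G hG0 hc ?_ v hv
  rw [hG]
  exact pencil_pow_mem _ p _ _ (fun j hj => by
    rw [← map_pow, ← map_pow, ← map_mul]; exact rename_mem_span_pow k p _ (hdeep j hj)) _

/-- ★ **THE POINT `W = ∞` IS NOT FULL EITHER**: the origin of `V(B·X_n − M) ⊂ 𝔸^{n+1}` (the `U`-chart `{B·U = M}` at `U = 0` over `Q`) is NOT `FullCl p` (same hypotheses).
[OURS · certificate; cite: Fedder1983, Thm. 1.12] -/
theorem pencilChart_not_full_infty (k : Type) [Field k] (p : ℕ) [Fact p.Prime] [CharP k p] {n : ℕ} (M B : MvPolynomial (Fin n) k) (hM : M ≠ 0)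
    (hM0 : constantCoeff M = 0)
    (hdeep : ∀ j ≤ p - 1, M ^ j * B ^ (p - 1 - j) ∈ Ideal.span (Set.range fun i : Fin n => (X i : MvPolynomial (Fin n) k) ^ p))
    (G : MvPolynomial (Fin (n + 1)) k)
    (hG : G = rename (Fin.castSucc : Fin n → Fin (n + 1)) B * X (Fin.last n) - rename (Fin.castSucc : Fin n → Fin (n + 1)) M)
    (v : Spec (.of (MvPolynomial (Fin (n + 1)) k ⧸ Ideal.span {G})))
    (hv : v.asIdeal = Ideal.span (Set.range fun j : Fin (n + 1) => Ideal.Quotient.mk (Ideal.span {G}) (X j))) :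
    ¬ FullCl p ((Spec (.of (MvPolynomial (Fin (n + 1)) k ⧸ Ideal.span {G}))).presheaf.stalk v) := by
  have hG0 : G ≠ 0 := by
    -- set `X_n = 0`: `G ↦ −M ≠ 0`
    intro h0
    have := congrArg (MvPolynomial.aeval (fun j : Fin (n + 1) => if j = Fin.last n then (0 : MvPolynomial (Fin (n + 1)) k) else X j)) h0
    rw [hG, map_sub, map_mul, aeval_X, if_pos rfl, mul_zero, zero_sub, map_zero, neg_eq_zero, aeval_rename] at this
    have hid : ((fun j : Fin (n + 1) => if j = Fin.last n then (0 : MvPolynomial (Fin (n + 1)) k) else X j) ∘ Fin.castSucc) = X ∘ Fin.castSucc :=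
      funext fun j => by simp only [Function.comp_apply]; rw [if_neg (Fin.castSucc_lt_last j).ne]
    rw [hid, ← aeval_rename, aeval_X_left_apply] at this
    exact hM (rename_injective _ (Fin.castSucc_injective _) (by rw [this, map_zero]))
  have hc : constantCoeff G = 0 := by
    rw [hG, map_sub, map_mul, constantCoeff_rename, constantCoeff_rename, constantCoeff_X, hM0]; ring
  refine HypersurfaceOriginNotFull.not_fullCl_stalk_origin_of_fedder_mem p k G hG0 hc ?_ v hv
  rw [hG]
  exact pencil_pow_mem' _ p _ _ (fun j hj => by
    rw [← map_pow, ← map_pow, ← map_mul]; exact rename_mem_span_pow k p _ (hdeep j hj)) _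

/-! ## §3 Legality, CM half: the pencil chart over a class-model chart is a codimension-2 complete intersection -/

/-- `G ∤ M·W − B` when `G ∤ M` and `G, M, B` do not involve `W` (compare the `∂_W`-derivatives). [elementary] -/
theorem not_dvd_pencil_of_not_dvd (k : Type) [Field k] {m : ℕ} (w : Fin m) (G M B : MvPolynomial (Fin m) k)
    (hGw : pderiv w G = 0) (hMw : pderiv w M = 0) (hBw : pderiv w B = 0) (hGM : ¬ G ∣ M) : ¬ G ∣ (M * X w - B) := by
  rintro ⟨q, hq⟩
  apply hGM
  have h := congrArg (pderiv w) hq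
  rw [map_sub, Derivation.leibniz, hMw, pderiv_X_self, hBw, Derivation.leibniz, hGw, smul_eq_mul, smul_eq_mul, smul_eq_mul, smul_zero, add_zero, sub_zero, mul_one, mul_zero,
    add_zero] at h
  exact ⟨pderiv w q, h⟩

/-- **THE CM CLAUSE OF THE PENCIL CHART** `k[Y]/(G, M·Y_w − B)` at every stalk, for `G` prime not dividing `M` and `G, M, B` free of the variable `Y_w` (a codimension-2 complete
intersection; ✓ `CICodimTwoCM.cmCl_stalk_of_prime_of_not_dvd`). Integrality is a separate per-row hypothesis. [folklore] -/
theorem pencilChart_cmCl (k : Type) [Field k] {m : ℕ} (w : Fin m) (G M B : MvPolynomial (Fin m) k) (hG : Prime G)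
    (hGw : pderiv w G = 0) (hMw : pderiv w M = 0) (hBw : pderiv w B = 0) (hGM : ¬ G ∣ M)
    (y : Spec (.of (MvPolynomial (Fin m) k ⧸ Ideal.span {G, M * X w - B}))) :
    CMCl ((Spec (.of (MvPolynomial (Fin m) k ⧸ Ideal.span {G, M * X w - B}))).presheaf.stalk y) :=
  CICodimTwoCM.cmCl_stalk_of_prime_of_not_dvd k G (M * X w - B) hG (not_dvd_pencil_of_not_dvd k w G M B hGw hMw hBw hGM) y

end Summit.ResolutionOfSingularities.ResolutionOfSingularities.Theorems.FInjectiveMacaulayfication.PencilFedder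

end
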